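import Mathlib.RingTheory.MvPolynomial.Ideal
import Mathlib.Data.Finsupp.Weight
import Mathlib.Algebra.MvPolynomial.Rename
import Mathlib.Algebra.Ring.GeomSum
import Mathlib.Data.Nat.Prime.Basic
import Mathlib.Tactic
import HarnessLib

/-!
# (T-register #9, wild class — kernel brick K3) A FULL POINT IS NEVER AN ANTELOPE POINT when `p > dim`:
# Fedder's survivor excludes Hauser's kangaroo conditions (1) + (2)
# (crux `FInjectiveMacaulayfication` stmt-ResolutionOfSingularities-15315, chain w45a; `Cruxes/…/Lines/T-register.md` §5 (#8 verdict: the crux's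
# F-hypothesis can only bite on WILD beds `x^p = H(y)`); seat res-L1-w45a-lead-1 g13)

[OURS · L1 W4.5a] Support file (`--supports stmt-ResolutionOfSingularities-15315 --as helper`); def-free; UNCONDITIONAL; no named fact; pure
exponent combinatorics in a polynomial ring over any commutative ring. NOT a statement of any manuscript; evidence for nothing beyond itself; T″ and
the F-half OPEN; nothing of the crux proved. AI-written (AI review is weaker than expert review).

SETTING [cite: Hauser2010, §G «Kangaroo Theorem» (Bull. AMS 47, pp. 17–18); Fedder1983, Thm. 1.12]. A purely inseparable hypersurface singularity of
order `p = char k` at a closed point `a` of `W = 𝔸^{1+m}`, after the earlier blow-ups, has an equation `f = x^p + y^r · g(y)` with `y^r`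
(`r ∈ ℕ^m`) the exceptional monomial and `shade_a f = ord_a g`. Hauser's Kangaroo Theorem: if `a` is a WILD singularity (an antelope point: the
point blow-up of `a` has a kangaroo point `a′` over it, i.e. the characteristic-zero resolution invariant INCREASES at `a′`) then necessarily
(1) `|r| + ord_a g ≡ 0 (mod p)` and (2) `r̄₁ + ⋯ + r̄_m ≤ (φ_p(r) − 1)·p`, `r̄ᵢ` the residue of `rᵢ` mod `p`, `φ_p(r) = #{i : r̄ᵢ ≠ 0}` (+ (3), (4)).
FEDDER: the hypersurface `{f = 0}` is F-pure (= the crux's FULL clause, hypersurfaces being Gorenstein) at `a` iff `f^{p−1} ∉ 𝔪^{[p]} =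
(x^p, y₁^p, …, y_m^p)`, and `f^{p−1} ≡ (y^r g)^{p−1} (mod x^p)` (`survivor_iff_of_eq_X_pow_add`), so iff `(y^r g)^{p−1} ∉ (y₁^p, …, y_m^p)` — a
«Fedder survivor»; only `g mod (y)^{N}` matters, so `g` may be taken polynomial.

THE THEOREM ★★ `not_kangaroo_of_survivor`: if `m < p` then a Fedder survivor for `y^r g` is INCOMPATIBLE with (1) ∧ (2). Proof: a surviving monomial
of `(y^r g)^{p−1} = y^{(p−1)r} g^{p−1}` has all exponents `≤ p − 1`, forcing `rᵢ ∈ {0,1}`, and it is `y^{(p−1)r} · y^e` with `y^e` a monomial of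
`g^{p−1}` vanishing on the `s := |r|` indices with `rᵢ = 1`; so `(p−1)·ord g ≤ deg y^e ≤ (m − s)(p − 1)`, i.e. `ord g ≤ m − s`. With `rᵢ ∈ {0,1}`
condition (2) reads `s ≤ (s − 1)p`, i.e. `s ≥ 2`; then `2 ≤ s + ord g ≤ m < p` contradicts (1). CONSEQUENCE (dim `X = m = 4`, every `p ≥ 5`):
over a FULL closed point of a purely inseparable order-`p` floor no kangaroo point arises at the next point blow-up — the first THEOREM-shaped
instance where the crux's F-hypothesis acts on the resolution recipe, and it acts in the wild class singled out by the #8 verdict. LIMITS (stated,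
not hidden): Hauser's (1)–(4) are NECESSARY conditions (so the theorem forbids kangaroos, it does not construct resolutions); F-purity is not
stable under blow-up (the theorem controls ONE step); `p ∈ {2, 3}` in dim 4 is NOT covered and there survivor + (1) + (2) IS satisfiable
(`x³ + y₁y₂y₃`: `r = (1,1,0,0)`, `g = y₃`, `p = 3`).
CORRIGENDUM AND SHARPENING (same seat, same session, §2): the survivor alone already bounds the ORDER — `φ^{p−1} ∉ (y₁^p,…,y_m^p) ⇒ φ` has a
monomial of degree `≤ m` (`exists_degree_le_of_survivor`); hence for `p > m` a purely inseparable point `x^p + G(y)` of ORDER `≥ p` is NEVER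
F-pure (`not_survivor_of_order_ge`). In Hauser's setting (`ord f = p`) with `p > dim` there are therefore NO FULL points at all, and
`not_kangaroo_of_survivor` (true as stated) is superseded: conditions (1)(2) are not needed. The honest headline is «on a FULL floor of dimension
`m`, `char = p > m`, no point is an order-`p` purely inseparable hypersurface point: multiplicity `< p`, so `e!` is invertible and derivative
maximal contact is available at every FULL point» — F-leverage of the simplest kind, still one step only and silent for `p ≤ m`.
* `exists_support_lt_of_not_mem` (survivor ⇒ a monomial with all exponents `< p`), `le_degree_of_mem_support_pow` (monomials of `g^j` have degree
  `≥ j · ord g`), `le_and_mem_support_of_mem_support_monomial_mul`, ★★ `not_kangaroo_of_survivor`, `survivor_iff_of_eq_X_pow_add` (`x^p` is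
  invisible to Fedder: `(x^p + G)^{p−1}` survives iff `G^{p−1}` does), ★ `not_kangaroo_of_survivor'` (the same with the survivor of `f` itself);
  §2 ★★ `exists_degree_le_of_survivor`, `map_rename_succ_span_le`, ★★ `not_survivor_of_order_ge`.
[cite: Hauser2010, §G Kangaroo Theorem, Remarks (b)(c); Fedder1983, Thm. 1.12; Moh1987 (context: condition (1))] [folklore computation beyond the cited statements]
-/

-- single-problem summit: the doubled namespace component is forced
set_option linter.dupNamespace false

noncomputable section

open MvPolynomial Finsupp

namespace Summit.ResolutionOfSingularities.ResolutionOfSingularities.Theorems.FInjectiveMacaulayfication.FullNoKangaroo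

variable {A : Type} [CommRing A] {m : ℕ}

/-- A polynomial outside the Frobenius-power monomial ideal `(y₁^p, …, y_m^p)` has a monomial with every exponent `< p` (a «survivor»).
[plumbing; Mathlib `mem_ideal_span_monomial_image`] -/
theorem exists_support_lt_of_not_mem (p : ℕ) (φ : MvPolynomial (Fin m) A)
    (hφ : φ ∉ Ideal.span (Set.range fun i : Fin m => (X i : MvPolynomial (Fin m) A) ^ p)) :
    ∃ d ∈ φ.support, ∀ i, d i < p := by
  by_contra! h
  apply hφ
  have hset : Set.range (fun i : Fin m => (X i : MvPolynomial (Fin m) A) ^ p) =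
      (fun s => monomial s (1 : A)) '' Set.range (fun i : Fin m => Finsupp.single i p) := by
    ext q
    constructor
    · rintro ⟨i, rfl⟩
      exact ⟨Finsupp.single i p, ⟨i, rfl⟩, X_pow_eq_monomial.symm⟩
    · rintro ⟨s, ⟨i, rfl⟩, rfl⟩
      exact ⟨i, X_pow_eq_monomial⟩
  rw [hset, mem_ideal_span_monomial_image]
  intro d hd
  obtain ⟨i, hi⟩ := h d hd
  exact ⟨Finsupp.single i p, ⟨i, rfl⟩, Finsupp.single_le_iff.mpr hi⟩

/-- Every monomial of `g^j` has degree `≥ j·n` when every monomial of `g` has degree `≥ n` (`n ≤ ord g`). [plumbing] -/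
theorem le_degree_of_mem_support_pow (g : MvPolynomial (Fin m) A) (n : ℕ) (hn : ∀ d ∈ g.support, n ≤ degree d) :
    ∀ j : ℕ, ∀ e ∈ (g ^ j).support, j * n ≤ degree e := by
  intro j
  induction j with
  | zero => intro e _; simp
  | succ j ih =>
    intro e he
    rw [pow_succ] at he
    obtain ⟨a, ha, b, hb, rfl⟩ := Finset.mem_add.mp (support_mul _ _ he)
    rw [map_add, Nat.succ_mul]
    exact add_le_add (ih a ha) (hn b hb)

/-- A monomial of `y^s · q` is `y^s · (a monomial of q)`. [plumbing] -/
theorem le_and_mem_support_of_mem_support_monomial_mul (s : Fin m →₀ ℕ) (q : MvPolynomial (Fin m) A) (d : Fin m →₀ ℕ)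
    (hd : d ∈ (monomial s (1 : A) * q).support) : s ≤ d ∧ (d - s) ∈ q.support := by
  rw [MvPolynomial.mem_support_iff, coeff_monomial_mul'] at hd
  split_ifs at hd with h
  · exact ⟨h, MvPolynomial.mem_support_iff.mpr (by rwa [one_mul] at hd)⟩
  · exact absurd rfl hd

/-- ★★ **A Fedder survivor excludes Hauser's kangaroo conditions (1) + (2) when `m < p`.** For `r ∈ ℕ^m`, `g ∈ A[y₁, …, y_m]` with every
monomial of degree `≥ n`, and a prime `p > m`: if `(y^r g)^{p−1} ∉ (y₁^p, …, y_m^p)` (the point is F-pure / FULL, by Fedder) then it is impossible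
that both `p ∣ |r| + n` (condition (1), with `n = ord g`) and `Σ r̄ᵢ ≤ (φ_p(r) − 1)·p` (condition (2)) hold. Hence, for `p > dim X`, an F-pure
closed point of a purely inseparable order-`p` hypersurface is never an antelope point: no kangaroo point lies over it.
[OURS; cite: Hauser2010, §G Kangaroo Theorem (necessity of (1), (2)); Fedder1983, Thm. 1.12] -/
theorem not_kangaroo_of_survivor (p : ℕ) (hp : p.Prime) (hpm : m < p) (r : Fin m →₀ ℕ) (g : MvPolynomial (Fin m) A) (n : ℕ)
    (hn : ∀ d ∈ g.support, n ≤ degree d)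
    (hF : (monomial r (1 : A) * g) ^ (p - 1) ∉ Ideal.span (Set.range fun i : Fin m => (X i : MvPolynomial (Fin m) A) ^ p))
    (h1 : p ∣ degree r + n)
    (h2 : ((∑ i : Fin m, r i % p : ℕ) : ℤ) ≤ (((Finset.univ.filter fun i : Fin m => r i % p ≠ 0).card : ℤ) - 1) * (p : ℤ)) : False := by
  have hp2 := hp.two_le
  -- (i) a surviving monomial `d = (p−1)•r + e`, `e` a monomial of `g^{p−1}`
  obtain ⟨d, hd, hdp⟩ := exists_support_lt_of_not_mem p _ hF
  rw [mul_pow, monomial_pow, one_pow] at hd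
  obtain ⟨hle, he⟩ := le_and_mem_support_of_mem_support_monomial_mul _ _ d hd
  set e := d - (p - 1) • r with he_def
  have hde : d = (p - 1) • r + e := (add_tsub_cancel_of_le hle).symm
  have hei : ∀ i, (p - 1) * r i + e i ≤ p - 1 := by
    intro i
    have := hdp i
    rw [hde] at this
    simp only [Finsupp.add_apply, Finsupp.smul_apply, smul_eq_mul] at this
    omega
  -- (ii) `rᵢ ≤ 1`
  have hri : ∀ i, r i ≤ 1 := by
    intro i
    by_contra! hc
    have h2r : (p - 1) * 2 ≤ (p - 1) * r i := Nat.mul_le_mul_left _ hc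
    have := hei i
    omega
  -- (iii) degree count: `(p−1)·n ≤ deg e` and `deg e + (p−1)|r| ≤ m(p−1)`, so `n + |r| ≤ m`
  have hlow : (p - 1) * n ≤ degree e := le_degree_of_mem_support_pow g n hn (p - 1) e he
  have hsum : degree e + (p - 1) * degree r ≤ m * (p - 1) := by
    have h := Finset.sum_le_sum fun i (_ : i ∈ (Finset.univ : Finset (Fin m))) => hei i
    simp only [Finset.sum_const, Finset.card_univ, Fintype.card_fin, smul_eq_mul] at h
    rw [Finset.sum_add_distrib, ← Finset.mul_sum] at h
    rw [degree_eq_sum, degree_eq_sum]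
    linarith
  have hkey : n + degree r ≤ m := by
    have h3 : (p - 1) * (n + degree r) ≤ (p - 1) * m := by
      rw [mul_add]
      calc (p - 1) * n + (p - 1) * degree r ≤ degree e + (p - 1) * degree r := Nat.add_le_add_right hlow _
        _ ≤ m * (p - 1) := hsum
        _ = (p - 1) * m := mul_comm _ _
    exact Nat.le_of_mul_le_mul_left h3 (by omega)
  -- (iv) condition (2) with `rᵢ ∈ {0,1}` says `|r| ≥ 2`
  have h01 : ∀ i, r i = 0 ∨ r i = 1 := fun i => by have := hri i; omega
  have hmod : ∀ i, r i % p = r i := fun i => Nat.mod_eq_of_lt (by have := hri i; omega)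
  have hsumN : ∑ i : Fin m, r i % p = degree r := by
    rw [degree_eq_sum]
    exact Finset.sum_congr rfl fun i _ => hmod i
  have hcardN : (Finset.univ.filter fun i : Fin m => r i % p ≠ 0).card = degree r := by
    rw [Finset.card_filter, degree_eq_sum]
    refine Finset.sum_congr rfl fun i _ => ?_
    rw [hmod i]
    rcases h01 i with h | h <;> simp [h]
  rw [hsumN, hcardN] at h2
  have hs2 : 2 ≤ degree r := by
    by_contra! hc
    have hs1 : ((degree r : ℕ) : ℤ) ≤ 1 := by exact_mod_cast Nat.lt_succ_iff.mp hc
    have hp2' : (2 : ℤ) ≤ p := by exact_mod_cast hp2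
    nlinarith
  -- (v) `2 ≤ |r| + n ≤ m < p` contradicts (1)
  have hle' := Nat.le_of_dvd (by omega) h1
  omega

/-- `x^p` is invisible to Fedder's test: `(x^p + G)^{p−1} ∉ (x^p, (yᵢ^p)ᵢ) ↔ G^{p−1} ∉ (x^p, (yᵢ^p)ᵢ)` — here in one polynomial ring
`A[X₀, …, X_m]` with `x = X₀`, for ANY `G` and any exponent `N` in place of `p − 1`. [plumbing; `(a + b)^N − b^N ∈ (a)`] -/
theorem survivor_iff_of_eq_X_pow_add (p N : ℕ) (hp : 0 < p) (f G : MvPolynomial (Fin (m + 1)) A) (hf : f = X 0 ^ p + G) :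
    f ^ N ∉ Ideal.span (Set.range fun i : Fin (m + 1) => (X i : MvPolynomial (Fin (m + 1)) A) ^ p) ↔
      G ^ N ∉ Ideal.span (Set.range fun i : Fin (m + 1) => (X i : MvPolynomial (Fin (m + 1)) A) ^ p) := by
  have _ := hp
  set I := Ideal.span (Set.range fun i : Fin (m + 1) => (X i : MvPolynomial (Fin (m + 1)) A) ^ p) with hI
  have hx : (X 0 : MvPolynomial (Fin (m + 1)) A) ^ p ∈ I := Ideal.subset_span ⟨0, rfl⟩
  have hdiff : f ^ N - G ^ N ∈ I := by
    obtain ⟨c, hc⟩ := sub_dvd_pow_sub_pow f G N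
    rw [hc, hf, add_sub_cancel_right]
    exact I.mul_mem_right c hx
  refine not_congr ⟨fun h => ?_, fun h => ?_⟩
  · have := I.sub_mem h hdiff
    rwa [sub_sub_cancel] at this
  · have := I.add_mem h hdiff
    rwa [add_sub_cancel] at this

/-- ★ **The same, with the Fedder survivor of `f = x^p + y^r g` itself** (`x = X₀`, `yᵢ = X_{i+1}` in `A[X₀, …, X_m]`): for a prime `p > m`,
`f^{p−1} ∉ (X₀^p, …, X_m^p)` (F-purity of `{f = 0}` at the origin, Fedder) is incompatible with Hauser's conditions (1) ∧ (2).
[OURS; cite: Hauser2010, §G Kangaroo Theorem; Fedder1983, Thm. 1.12] -/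
theorem not_kangaroo_of_survivor' (p : ℕ) (hp : p.Prime) (hpm : m < p) (r : Fin m →₀ ℕ) (g : MvPolynomial (Fin m) A) (n : ℕ)
    (hn : ∀ d ∈ g.support, n ≤ degree d) (f : MvPolynomial (Fin (m + 1)) A)
    (hf : f = X 0 ^ p + rename Fin.succ (monomial r (1 : A) * g))
    (hF : f ^ (p - 1) ∉ Ideal.span (Set.range fun i : Fin (m + 1) => (X i : MvPolynomial (Fin (m + 1)) A) ^ p))
    (h1 : p ∣ degree r + n)
    (h2 : ((∑ i : Fin m, r i % p : ℕ) : ℤ) ≤ (((Finset.univ.filter fun i : Fin m => r i % p ≠ 0).card : ℤ) - 1) * (p : ℤ)) : False := by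
  refine not_kangaroo_of_survivor p hp hpm r g n hn ?_ h1 h2
  intro hmem
  apply (survivor_iff_of_eq_X_pow_add p (p - 1) hp.pos f _ hf).mp hF
  rw [← map_pow]
  have hle : Ideal.map (rename Fin.succ) (Ideal.span (Set.range fun i : Fin m => (X i : MvPolynomial (Fin m) A) ^ p)) ≤
      Ideal.span (Set.range fun i : Fin (m + 1) => (X i : MvPolynomial (Fin (m + 1)) A) ^ p) := by
    rw [Ideal.map_span]
    refine Ideal.span_mono ?_
    rintro _ ⟨_, ⟨j, rfl⟩, rfl⟩
    exact ⟨Fin.succ j, by simp [rename_X]⟩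
  exact hle (Ideal.mem_map_of_mem _ hmem)

/-! ## §2 Corrigendum and sharpening: a Fedder survivor bounds the ORDER by the number of variables -/

/-- ★★ **A Fedder survivor bounds the order: if `φ^{p−1} ∉ (y₁^p, …, y_m^p)` (`p ≥ 2`) then `φ` has a monomial of degree `≤ m`.** Every monomial of
`φ^{p−1}` has degree `≥ (p−1)·ord φ`, while a surviving monomial (all exponents `≤ p−1`) has degree `≤ m(p−1)`. [folklore; cite: Fedder1983, Thm. 1.12 (context)] -/
theorem exists_degree_le_of_survivor (p : ℕ) (hp : 2 ≤ p) (φ : MvPolynomial (Fin m) A)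
    (hF : φ ^ (p - 1) ∉ Ideal.span (Set.range fun i : Fin m => (X i : MvPolynomial (Fin m) A) ^ p)) :
    ∃ d ∈ φ.support, degree d ≤ m := by
  by_contra! h
  obtain ⟨d, hd, hdp⟩ := exists_support_lt_of_not_mem p _ hF
  have hlow : (p - 1) * (m + 1) ≤ degree d := le_degree_of_mem_support_pow φ (m + 1) (fun e he => h e he) (p - 1) d hd
  have hhigh : degree d ≤ m * (p - 1) := by
    rw [degree_eq_sum]
    have hs := Finset.sum_le_sum fun i (_ : i ∈ (Finset.univ : Finset (Fin m))) => Nat.le_sub_one_of_lt (hdp i)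
    simpa [Finset.sum_const, smul_eq_mul] using hs
  have h3 : (p - 1) * (m + 1) ≤ (p - 1) * m := hlow.trans (by rw [mul_comm]; exact hhigh)
  have h4 := Nat.le_of_mul_le_mul_left h3 (by omega)
  omega

/-- The Frobenius-power monomial ideal is respected by adjoining the variable `X₀`: `rename Fin.succ` maps `(y₁^p,…,y_m^p)` into `(X₀^p,…,X_m^p)`. [plumbing] -/
theorem map_rename_succ_span_le (p : ℕ) :
    Ideal.map (rename Fin.succ) (Ideal.span (Set.range fun i : Fin m => (X i : MvPolynomial (Fin m) A) ^ p)) ≤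
      Ideal.span (Set.range fun i : Fin (m + 1) => (X i : MvPolynomial (Fin (m + 1)) A) ^ p) := by
  rw [Ideal.map_span]
  refine Ideal.span_mono ?_
  rintro _ ⟨_, ⟨j, rfl⟩, rfl⟩
  exact ⟨Fin.succ j, by simp [rename_X]⟩

/-- ★★ **For `p > m`, a purely inseparable point `f = x^p + G(y₁,…,y_m)` of ORDER `≥ p` (every monomial of `G` of degree `≥ p`) is NEVER F-pure:
`f^{p−1} ∈ (x^p, y₁^p, …, y_m^p)`.** So in Hauser's kangaroo setting (`ord f = p`) with `p > dim` no point is FULL, which supersedes the use of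
conditions (1)(2) in `not_kangaroo_of_survivor`; equivalently, on a FULL `m`-fold floor in characteristic `p > m` every purely inseparable
hypersurface point `x^p + G(y)` has `ord G ≤ m < p` — multiplicity below the characteristic, where `e!` is a unit and derivative maximal contact exists.
[OURS; cite: Fedder1983, Thm. 1.12; Hauser2010, §G (context)] -/
theorem not_survivor_of_order_ge (p : ℕ) (hp : p.Prime) (hpm : m < p) (G : MvPolynomial (Fin m) A) (hG : ∀ d ∈ G.support, p ≤ degree d)
    (f : MvPolynomial (Fin (m + 1)) A) (hf : f = X 0 ^ p + rename Fin.succ G) :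
    f ^ (p - 1) ∈ Ideal.span (Set.range fun i : Fin (m + 1) => (X i : MvPolynomial (Fin (m + 1)) A) ^ p) := by
  by_contra hF
  have hG' := (survivor_iff_of_eq_X_pow_add p (p - 1) hp.pos f _ hf).mp hF
  have hGm : G ^ (p - 1) ∉ Ideal.span (Set.range fun i : Fin m => (X i : MvPolynomial (Fin m) A) ^ p) := by
    intro hmem
    apply hG'
    rw [← map_pow]
    exact map_rename_succ_span_le p (Ideal.mem_map_of_mem _ hmem)
  obtain ⟨d, hd, hdm⟩ := exists_degree_le_of_survivor p hp.two_le G hGm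
  have := hG d hd
  omega

end Summit.ResolutionOfSingularities.ResolutionOfSingularities.Theorems.FInjectiveMacaulayfication.FullNoKangaroo

end
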